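import Summits.QuantumFields.BalabanUV.Beta.PropagatorWoodburyFibre

/-!
# Beta / PropagatorWoodburyFibreGauge — the GAUGE SECTOR of a gauge-fixed block-averaging KKT system: the gauge multiplier DECOUPLES from
co-closed sources (abstract «divergence» argument), so the multiplier block is the gauge-INVARIANT effective form

Cell `pub-balaban`, β sub-cell, BINDER ROW **G-an2-4 ∕ (CONV-C)**, prover part **P3 = WOODBURY-FIBRE** (unit `b2b-balaban-gan24-p3`); third sibling
of `PropagatorWoodburyFibre` / `PropagatorWoodburyFibreReduction`.  HONEST FRAMING (verbatim): discharging `BetaPertH` makes Bałaban's UV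
stability UNCONDITIONAL — a real constructive-QFT result; it is NOT the continuum limit and NOT the Clay problem.  HONEST DEPENDENCY: continuum YM
on T⁴ ⇐ BetaPertH ∧ nine spine estimates (0/9 proved); BetaPertH ⇐ (D1) ∧ (D4) ∧ CAP+tail; G-an2-4 gates asym, D1 and NE2/3/4.  Everything below
is `[folklore]` finite-dimensional linear algebra over `ℝ`; nothing printed or programme-internal is a hypothesis.

WHY.  The located fibre term of the Woodbury-fibre route (cell GAPS G-gan24p3-1 (b), `HOME/b2b-balaban-gan24-p3/WOODBURY-FIBRE.md` §2 R6–R7) is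
the gauge sector of the cell's typed one-shot system (`Beta.BlochFibreMatrix`): stationarity rows `δ₂d₁A − Q*φ − dΔ₀μ = f` with a GAUGE
multiplier `μ` (normalised by zero block sums, the M row) next to the constraint multiplier `φ`.  The abstract lemma of this file isolates the
mechanism by which `μ` DROPS OUT for co-closed sources: a «divergence» `D` (there: `δ₁`) with `D·H = 0` (`δ₁δ₂ = 0`), `D·Qᵀ = Pᵀ·D_c`
(Bałaban's intertwining `Q d = ∂ Q′` [cite: Balaban1984PropagatorsI, (1.20) p.20] read dually — locator only), `−D·B = RᵀR` (there
`δ₁dΔ₀ = Δ₀²`, `R = Δ₀`) and the normalisation `P·μ = 0` (the M row, `P = Q′` = block sums) force `‖Rμ‖² = ⟨μ, Df⟩`; so `Df = 0 ⇒ Rμ = 0 ⇒ μ = 0`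
whenever `ker R ∩ ker P = 0` (constants killed by the block sums).  CONSEQUENCE (analysis, recorded in the report v1.1 R7′; the instantiation on
an2's typed operators is theirs to write): on the minimiser (`ℋ`) and multiplier (`𝒮`) blocks of the packed resolvent and on the covariance block
against conserved currents the gauge multiplier vanishes, the typed minimiser IS a constrained minimiser of the Wilson form in the weak gauge, and the
multiplier block IS minus Bałaban's gauge-invariant effective form — whose blocks compose exactly (two-stage minimisation; `effForm_comp`) and whose
`U = 1` rate is the tree's scalar-alias-sum rate.  What remains gauge-dependent (and `j`-dependent) is the pure-gauge part of the field legs.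

CONTENTS.  §1 `gaugeMultiplier_decouples` (the identity `‖Rμ‖² = μ·Df`), `gaugeMultiplier_eq_zero` (`Df = 0 ⇒ μ = 0`), and the corollary
`stationary_without_gauge_multiplier` (the stationarity row then reads `Hx − Qᵀφ = f`: a genuine constrained critical point).

v1.0.1 DOCFIX (same seat, after reading `Beta/ResolventComposition` of the an5 lineage, node BETA-an5-g13): the CONCRETE instances of this
mechanism for the cell's typed system are ALREADY IN THE TREE — `ResolventComposition.wM_eq_zero` (the gauge multiplier of every minimiser column
vanishes; same energy argument: `Δ₀² wM` block-constant by (EL), zero block means by (M), two adjunctions), `ResolventComposition.McolSum_eq_zero`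
(covariance fields with CO-CLOSED forces), together with the decisive record that the entrywise one-slice covariance telescoping `K1aNeg` is FALSE
for `j ≥ 1` («gauge-slice defect: the weak-Landau slice depends on `N`») while its TRANSVERSE form `K1aTrans` holds at every `j`
(`ResolventCompositionStepB.k1aTrans`, `k1_trio`).  So the «consequence» paragraph above is not new: it re-derives an5-g13's findings; what this file
adds is only the system-free matrix statement (any `H, Q, B, D, P, R` with the four identities), for use on Bloch fibres and in the report's R7′.
Priority and the kernel instances are an5's.
-/

namespace Summit.QuantumFields.BalabanUV.Beta.PropagatorWoodburyFibre

open Matrix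

section GaugeMultiplier

variable {n m p q c : Type*} [Fintype n] [Fintype m] [Fintype p] [Fintype q] [Fintype c]

/-- **The divergence identity.**  If `Hx − Qᵀφ − Bμ = f`, `D·H = 0`, `D·Qᵀ = Pᵀ·D_c`, `D·B = −RᵀR` and `P·μ = 0`, then
`(Rμ)·(Rμ) = μ·(D f)`. [folklore] -/
theorem gaugeMultiplier_decouples (H : Matrix n n ℝ) (Q : Matrix m n ℝ) (B : Matrix n p ℝ) (D : Matrix p n ℝ) (P : Matrix c p ℝ)
    (Dc : Matrix c m ℝ) (R : Matrix q p ℝ) (hDH : D * H = 0) (hDQ : D * Qᵀ = Pᵀ * Dc) (hDB : D * B = -(Rᵀ * R))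
    {x : n → ℝ} {φ : m → ℝ} {μ : p → ℝ} {f : n → ℝ} (hP : P *ᵥ μ = 0) (heq : H *ᵥ x - Qᵀ *ᵥ φ - B *ᵥ μ = f) :
    (R *ᵥ μ) ⬝ᵥ (R *ᵥ μ) = μ ⬝ᵥ (D *ᵥ f) := by
  have h1 : D *ᵥ f = -(Pᵀ *ᵥ (Dc *ᵥ φ)) + (Rᵀ * R) *ᵥ μ := by
    rw [← heq, Matrix.mulVec_sub, Matrix.mulVec_sub, Matrix.mulVec_mulVec, Matrix.mulVec_mulVec, Matrix.mulVec_mulVec, hDH, hDQ,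
      hDB, Matrix.zero_mulVec, zero_sub, ← Matrix.mulVec_mulVec, Matrix.neg_mulVec, sub_neg_eq_add]
  rw [h1, dotProduct_add, dotProduct_neg, Matrix.dotProduct_mulVec μ Pᵀ, Matrix.vecMul_transpose, hP, zero_dotProduct, neg_zero,
    zero_add, ← Matrix.mulVec_mulVec, Matrix.dotProduct_mulVec μ Rᵀ, Matrix.vecMul_transpose]

/-- **The gauge multiplier vanishes for co-closed sources**: under the hypotheses of `gaugeMultiplier_decouples`, if `D f = 0` and
`ker R ∩ ker P = 0` then `μ = 0`. [folklore] -/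
theorem gaugeMultiplier_eq_zero (H : Matrix n n ℝ) (Q : Matrix m n ℝ) (B : Matrix n p ℝ) (D : Matrix p n ℝ) (P : Matrix c p ℝ)
    (Dc : Matrix c m ℝ) (R : Matrix q p ℝ) (hDH : D * H = 0) (hDQ : D * Qᵀ = Pᵀ * Dc) (hDB : D * B = -(Rᵀ * R))
    (hker : ∀ v : p → ℝ, R *ᵥ v = 0 → P *ᵥ v = 0 → v = 0)
    {x : n → ℝ} {φ : m → ℝ} {μ : p → ℝ} {f : n → ℝ} (hP : P *ᵥ μ = 0) (heq : H *ᵥ x - Qᵀ *ᵥ φ - B *ᵥ μ = f)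
    (hf : D *ᵥ f = 0) : μ = 0 := by
  have h := gaugeMultiplier_decouples H Q B D P Dc R hDH hDQ hDB hP heq
  rw [hf, dotProduct_zero, dotProduct_self_eq_zero] at h
  exact hker μ h hP

/-- **Corollary: a genuine constrained critical point.**  With `μ = 0` the stationarity row is `Hx − Qᵀφ = f` — for `f = 0` (the minimiser
and multiplier blocks) `x` is a critical point of `½⟨x,Hx⟩` on `{Qx = g}` with Lagrange multiplier `φ`, whatever gauge rows were imposed.
[folklore] -/
theorem stationary_without_gauge_multiplier (H : Matrix n n ℝ) (Q : Matrix m n ℝ) (B : Matrix n p ℝ) (D : Matrix p n ℝ)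
    (P : Matrix c p ℝ) (Dc : Matrix c m ℝ) (R : Matrix q p ℝ) (hDH : D * H = 0) (hDQ : D * Qᵀ = Pᵀ * Dc) (hDB : D * B = -(Rᵀ * R))
    (hker : ∀ v : p → ℝ, R *ᵥ v = 0 → P *ᵥ v = 0 → v = 0)
    {x : n → ℝ} {φ : m → ℝ} {μ : p → ℝ} {f : n → ℝ} (hP : P *ᵥ μ = 0) (heq : H *ᵥ x - Qᵀ *ᵥ φ - B *ᵥ μ = f)
    (hf : D *ᵥ f = 0) : H *ᵥ x - Qᵀ *ᵥ φ = f := by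
  have hμ := gaugeMultiplier_eq_zero H Q B D P Dc R hDH hDQ hDB hker hP heq hf
  rw [hμ, Matrix.mulVec_zero, sub_zero] at heq
  exact heq

end GaugeMultiplier

end Summit.QuantumFields.BalabanUV.Beta.PropagatorWoodburyFibre
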